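import Summits.Schanuel.Schanuel.Theorems.ZilberEacRelationAllSurfaces
import Summits.Schanuel.Schanuel.Theorems.ZilberEacFibreCurveCylinderSwap
import Literature.RingTheory.Elimination.TopComponents
import HarnessLib

/-!
# Arbitrary base branches, CIV: THE CYLINDER CRITERION and THE COMPLETE VERDICT OVER CURVES
# DEFINED OVER `ℚ̄` WITH A HORIZONTAL ASYMPTOTE — every surface of Mantova–Masser's case is dense

HONEST FRAMING.  Cell `pub-schanuel` (Zilber's Exponential-Algebraic Closedness, case ladder;
host summit Schanuel), seat 2, gen 33.  File CIII decided every surface `W` of the case over a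
curve with a horizontal asymptote on which `x₀, x₁, y₁` satisfy no relation off `(F)`; file XCVIII
(over `ℚ̄`) every `W` invariant under `y₀ ↦ t`.  The two cases are exhaustive:
**`cylinder₀_of_relation`** — if some `H(x₀, x₁, y₁) ∉ (F)` vanishes on a surface `W` of the case
over `{F = 0}`, then `W` is invariant under `y₀ ↦ t`.  (Dimension count: `I(W)` contains the
extension `𝔮` of the prime `I(W) ∩ ℂ[x₀,x₁,y₁]`, and `(F) ⊊ 𝔮 ⊆ I(W)` with `dim ℂ[x]/(F) = 3`,
`dim W = 2` force `𝔮 = I(W)` — the tree's `ringKrullDim_quotient_add_one_le_of_lt`.)  Hence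
**`unprojectedDense_of_mmCase_topRowRoot_algebraic`**: for every irreducible `F ∈ ℚ̄[x₀][x₁]` of
`x₁`-degree `≥ 2` with a horizontal asymptote (a root of the top row) and irreducible transpose,
EVERY surface of Mantova–Masser's case with base curve `{F = 0}` has Zariski-dense exponential
points — e.g. every surface of the case over the conic `x₁² + x₀x₁ + x₀ = 0`
(**`unprojectedDense_of_mmCase_conicE_all`**).  What this is NOT: curves with no horizontal
asymptote (e.g. `x₁² = x₀³ + 1`), transcendental coefficients, Fib(3,2), EC(3,2) — OPEN; the
question OPEN in general; NOT Schanuel's conjecture (neither used nor implied); EAC ⇏ SC.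
-/

noncomputable section

open Filter Topology Set Complex Polynomial
open Literature.NumberTheory.Transcendental Literature.ModelTheory.Zilber
open Literature.ModelTheory.ExponentialFields

set_option linter.dupNamespace false

namespace Summit.Schanuel.Schanuel.Theorems

section CylinderCriterion

variable (F : ℂ[X][X])

/-- **The cylinder criterion.**  `F` irreducible; `F₃` = `F` in `ℂ[x₀, x₁, y₁]`; `W` in
Mantova–Masser's case with base curve `{F = 0}`; if some `H ∈ ℂ[x₀, x₁, y₁]` with `F₃ ∤ H`
vanishes on `W` (`y₁` the second multiplicative coordinate), then `W` is invariant under `y₀ ↦ t`.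
[folklore algebraic geometry] (new in this form) -/
theorem cylinder₀_of_relation (hFirr : Irreducible F) (F₃ : MvPolynomial (Fin 3) ℂ)
    (hF₃ : ∀ v : Fin 3 → ℂ, MvPolynomial.eval v F₃ = (F.map (Polynomial.evalRingHom (v 0))).eval (v 1))
    {W : Set (Fin 2 ⊕ Fin 2 → ℂ)} (hmm : MMCaseDimPiOneFree W)
    (hbase : MvPolynomial.zeroLocus ℂ (MvPolynomial.vanishingIdeal ℂ (projAdd '' (W ∩ torusLocus ℂ 2))) =
      {x : Fin 2 → ℂ | (F.map (Polynomial.evalRingHom (x 0))).eval (x 1) = 0})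
    (H : MvPolynomial (Fin 3) ℂ) (hH : ¬ F₃ ∣ H)
    (hHW : ∀ w ∈ W, MvPolynomial.eval ![w (Sum.inl 0), w (Sum.inl 1), w (Sum.inr 1)] H = 0) :
    ∀ w ∈ W, ∀ t : ℂ, Function.update w (Sum.inr 0) t ∈ W := by
  classical
  -- the embedding `ι : B[y₀] → ℂ[x₀, x₁, y₀, y₁]`, `B = ℂ[x₀, x₁, y₁]` (as in file CIII)
  set ι : Polynomial (MvPolynomial (Fin 3) ℂ) →+* MvPolynomial (Fin 2 ⊕ Fin 2) ℂ :=
    Polynomial.eval₂RingHom (MvPolynomial.eval₂Hom (S₁ := MvPolynomial (Fin 2 ⊕ Fin 2) ℂ)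
      MvPolynomial.C (![MvPolynomial.X (Sum.inl 0), MvPolynomial.X (Sum.inl 1),
        MvPolynomial.X (Sum.inr 1)] : Fin 3 → MvPolynomial (Fin 2 ⊕ Fin 2) ℂ))
      (MvPolynomial.X (Sum.inr 0)) with hι
  have hC : ∀ a : ℂ, ι (Polynomial.C (MvPolynomial.C a)) = MvPolynomial.C a := by
    intro a
    simp only [hι, Polynomial.coe_eval₂RingHom, Polynomial.eval₂_C, MvPolynomial.coe_eval₂Hom,
      MvPolynomial.eval₂_C]
  have h0 : ι (Polynomial.C (MvPolynomial.X 0)) = MvPolynomial.X (Sum.inl 0) := by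
    simp only [hι, Polynomial.coe_eval₂RingHom, Polynomial.eval₂_C, MvPolynomial.coe_eval₂Hom,
      MvPolynomial.eval₂_X, Matrix.cons_val_zero]
  have h1 : ι (Polynomial.C (MvPolynomial.X 1)) = MvPolynomial.X (Sum.inl 1) := by
    simp only [hι, Polynomial.coe_eval₂RingHom, Polynomial.eval₂_C, MvPolynomial.coe_eval₂Hom,
      MvPolynomial.eval₂_X, Matrix.cons_val_one, Matrix.cons_val_zero]
  have h2 : ι (Polynomial.C (MvPolynomial.X 2)) = MvPolynomial.X (Sum.inr 1) := by
    simp only [hι, Polynomial.coe_eval₂RingHom, Polynomial.eval₂_C, MvPolynomial.coe_eval₂Hom,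
      MvPolynomial.eval₂_X]; rfl
  have hX : ι Polynomial.X = MvPolynomial.X (Sum.inr 0) := by
    simp only [hι, Polynomial.coe_eval₂RingHom, Polynomial.eval₂_X]
  have hev := eval_embed₄ ι hC h0 h1 h2 hX
  -- `ι` is bijective
  have hinj : Function.Injective ι := by
    intro G₁ G₂ hG
    rw [← sub_eq_zero]
    have hzero : ι (G₁ - G₂) = 0 := by
      have h := congrArg (fun x => x - ι G₂) hG
      simp only [sub_self] at h
      rw [← map_sub] at h
      exact h
    refine Polynomial.ext fun m => MvPolynomial.funext fun v => ?_
    have hall : ∀ y : ℂ, ((G₁ - G₂).map (MvPolynomial.eval v)).eval y = 0 := by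
      intro y
      have h := hev (Sum.elim ![v 0, v 1] ![y, v 2]) (G₁ - G₂)
      rw [hzero, map_zero] at h
      have e : (![Sum.elim ![v 0, v 1] ![y, v 2] (Sum.inl 0), Sum.elim ![v 0, v 1] ![y, v 2] (Sum.inl 1),
          Sum.elim ![v 0, v 1] ![y, v 2] (Sum.inr 1)] : Fin 3 → ℂ) = v := by
        funext i; fin_cases i <;> rfl
      rw [e] at h
      simpa using h.symm
    have hp : (G₁ - G₂).map (MvPolynomial.eval v) = 0 := Polynomial.funext fun y => by
      rw [hall, Polynomial.eval_zero]
    have hm := congrArg (fun q : ℂ[X] => q.coeff m) hp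
    simp only [Polynomial.coeff_map, Polynomial.coeff_zero] at hm
    rw [Polynomial.coeff_zero, map_zero]
    exact hm
  have hsurj : Function.Surjective ι := fun G => exists_embed₄_poly ι hC h0 h1 h2 hX G
  set Ψ : Polynomial (MvPolynomial (Fin 3) ℂ) ≃+* MvPolynomial (Fin 2 ⊕ Fin 2) ℂ :=
    RingEquiv.ofBijective ι ⟨hinj, hsurj⟩ with hΨ
  have hΨι : ∀ G, Ψ G = ι G := fun G => rfl
  -- the prime `𝔭 = I(W)` and its trace `𝔭'` on `B`
  set 𝔭 : Ideal (MvPolynomial (Fin 2 ⊕ Fin 2) ℂ) := MvPolynomial.vanishingIdeal ℂ W with h𝔭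
  haveI h𝔭p : 𝔭.IsPrime := hmm.1.2
  set 𝔭' : Ideal (MvPolynomial (Fin 3) ℂ) := 𝔭.comap (ι.comp Polynomial.C) with h𝔭'
  haveI h𝔭'p : 𝔭'.IsPrime := Ideal.IsPrime.comap _
  have hmem' : ∀ G : MvPolynomial (Fin 3) ℂ, G ∈ 𝔭' ↔ ∀ w ∈ W,
      MvPolynomial.eval ![w (Sum.inl 0), w (Sum.inl 1), w (Sum.inr 1)] G = 0 := by
    intro G
    rw [h𝔭', Ideal.mem_comap, h𝔭, MvPolynomial.mem_vanishingIdeal_iff]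
    refine forall₂_congr fun w _ => ?_
    rw [MvPolynomial.aeval_eq_eval, RingHom.comp_apply, hev, Polynomial.map_C, Polynomial.eval_C]
  obtain ⟨w₀, hw₀W, hw₀T⟩ := hmm.2.1
  have hy : ∀ i : Fin 2, (MvPolynomial.X (Sum.inr i) : MvPolynomial (Fin 2 ⊕ Fin 2) ℂ) ∉ 𝔭 := by
    intro i hi
    rw [h𝔭, MvPolynomial.mem_vanishingIdeal_iff] at hi
    have h := hi w₀ hw₀W
    rw [MvPolynomial.aeval_eq_eval, MvPolynomial.eval_X] at h
    exact (mem_torusLocus_iff.1 hw₀T) i h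
  -- `F₃ ∈ 𝔭'`, `H ∈ 𝔭'`
  have hFW : ∀ w ∈ W, w ∈ torusLocus ℂ 2 →
      (F.map (Polynomial.evalRingHom (w (Sum.inl 0)))).eval (w (Sum.inl 1)) = 0 := by
    intro w hwW hwT
    have hcl : projAdd w ∈ MvPolynomial.zeroLocus ℂ
        (MvPolynomial.vanishingIdeal ℂ (projAdd '' (W ∩ torusLocus ℂ 2))) :=
      MvPolynomial.zeroLocus_vanishingIdeal_le _ ⟨w, ⟨hwW, hwT⟩, rfl⟩
    rw [hbase] at hcl
    exact hcl
  have hF' : F₃ ∈ 𝔭' := by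
    have hprod : ι (Polynomial.C F₃) * MvPolynomial.X (Sum.inr 0) * MvPolynomial.X (Sum.inr 1) ∈ 𝔭 := by
      rw [h𝔭, MvPolynomial.mem_vanishingIdeal_iff]
      intro w hwW
      rw [MvPolynomial.aeval_eq_eval, map_mul, map_mul, hev, MvPolynomial.eval_X, MvPolynomial.eval_X,
        Polynomial.map_C, Polynomial.eval_C, hF₃]
      simp only [Matrix.cons_val_zero, Matrix.cons_val_one]
      by_cases hwT : w ∈ torusLocus ℂ 2
      · rw [hFW w hwW hwT, zero_mul, zero_mul]
      · rw [mem_torusLocus_iff] at hwT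
        push Not at hwT
        obtain ⟨i, hi⟩ := hwT
        fin_cases i
        · simp only [Fin.zero_eta] at hi; rw [hi, mul_zero, zero_mul]
        · simp only [Fin.mk_one] at hi; rw [hi, mul_zero]
    have hF𝔭 : ι (Polynomial.C F₃) ∈ 𝔭 := by
      rcases h𝔭p.mem_or_mem hprod with h | h
      · exact (h𝔭p.mem_or_mem h).elim id fun h' => (hy 0 h').elim
      · exact (hy 1 h).elim
    rw [h𝔭', Ideal.mem_comap]; exact hF𝔭
  have hH' : H ∈ 𝔭' := (hmem' H).2 hHW
  -- `F₃` is prime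
  obtain ⟨Φr, hΦr⟩ := exists_rowsEquiv
  have hF₃eq : F₃ = MvPolynomial.rename (Fin.castSucc : Fin 2 → Fin 3) (Φr.symm F) := by
    refine MvPolynomial.funext fun v => ?_
    rw [hF₃, MvPolynomial.eval_rename]
    have e : (v ∘ (Fin.castSucc : Fin 2 → Fin 3)) = ![v 0, v 1] := by
      funext i; fin_cases i <;> rfl
    rw [e, hΦr, RingEquiv.apply_symm_apply]
  have hirrA : Irreducible (Φr.symm F) := by
    refine (irreducible_rows_iff (Q := F) fun x y => ?_).2 hFirr
    rw [hΦr, RingEquiv.apply_symm_apply]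
  have hprimeF₃ : Prime F₃ := by
    rw [hF₃eq]
    exact UniqueFactorizationMonoid.irreducible_iff_prime.1 (irreducible_rename_castSucc₂ hirrA)
  -- transport to `ℂ[X₀, …, X₃]`: `Θ = f ∘ Ψ`
  set f : MvPolynomial (Fin 2 ⊕ Fin 2) ℂ ≃+* MvPolynomial (Fin 4) ℂ :=
    (MvPolynomial.renameEquiv ℂ finSumFinEquiv).toRingEquiv with hf
  set Θ : Polynomial (MvPolynomial (Fin 3) ℂ) ≃+* MvPolynomial (Fin 4) ℂ := Ψ.trans f with hΘ
  set 𝔭₄ : Ideal (MvPolynomial (Fin 4) ℂ) :=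
    𝔭.map (f : MvPolynomial (Fin 2 ⊕ Fin 2) ℂ →+* MvPolynomial (Fin 4) ℂ) with h𝔭₄
  set 𝔮₀ : Ideal (Polynomial (MvPolynomial (Fin 3) ℂ)) :=
    𝔭'.map (Polynomial.C : MvPolynomial (Fin 3) ℂ →+* Polynomial (MvPolynomial (Fin 3) ℂ)) with h𝔮₀
  set 𝔮₄ : Ideal (MvPolynomial (Fin 4) ℂ) :=
    𝔮₀.map (Θ : Polynomial (MvPolynomial (Fin 3) ℂ) →+* MvPolynomial (Fin 4) ℂ) with h𝔮₄
  haveI h𝔭₄p : 𝔭₄.IsPrime := Ideal.map_isPrime_of_equiv _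
  haveI h𝔮₀p : 𝔮₀.IsPrime := (Ideal.isPrime_map_C_iff_isPrime 𝔭').2 h𝔭'p
  haveI h𝔮₄p : 𝔮₄.IsPrime := Ideal.map_isPrime_of_equiv _
  set F₄ : MvPolynomial (Fin 4) ℂ := Θ (Polynomial.C F₃) with hF₄
  have hprimeF₄ : Prime F₄ :=
    (MulEquiv.prime_iff Θ).2 (Polynomial.prime_C_iff.2 hprimeF₃)
  haveI hF₄p : (Ideal.span {F₄} : Ideal (MvPolynomial (Fin 4) ℂ)).IsPrime :=
    (Ideal.span_singleton_prime hprimeF₄.ne_zero).2 hprimeF₄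
  -- inclusions
  have hΘ𝔮 : ∀ G : MvPolynomial (Fin 3) ℂ, G ∈ 𝔭' → Θ (Polynomial.C G) ∈ 𝔮₄ := fun G hG =>
    Ideal.mem_map_of_mem _ (Ideal.mem_map_of_mem _ hG)
  have h1 : (Ideal.span {F₄} : Ideal (MvPolynomial (Fin 4) ℂ)) ≤ 𝔮₄ :=
    (Ideal.span_singleton_le_iff_mem _).2 (hΘ𝔮 F₃ hF')
  have h1ne : (Ideal.span {F₄} : Ideal (MvPolynomial (Fin 4) ℂ)) ≠ 𝔮₄ := by
    intro heq
    have hHmem : Θ (Polynomial.C H) ∈ Ideal.span {F₄} := by rw [heq]; exact hΘ𝔮 H hH'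
    rw [Ideal.mem_span_singleton, hF₄] at hHmem
    obtain ⟨c, hc⟩ := hHmem
    apply hH
    have hc' : Polynomial.C H = Polynomial.C F₃ * Θ.symm c := by
      apply Θ.injective; rw [map_mul, RingEquiv.apply_symm_apply]; exact hc
    have h0 := congrArg (fun q : Polynomial (MvPolynomial (Fin 3) ℂ) => q.coeff 0) hc'
    simp only [Polynomial.coeff_C_zero, Polynomial.coeff_C_mul] at h0
    exact ⟨_, h0⟩
  have h2 : 𝔮₄ ≤ 𝔭₄ := by
    rw [h𝔮₄, Ideal.map_le_iff_le_comap, h𝔮₀, Ideal.map_le_iff_le_comap]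
    intro G hG
    rw [Ideal.mem_comap, Ideal.mem_comap]
    show Θ (Polynomial.C G) ∈ 𝔭₄
    rw [hΘ, RingEquiv.coe_trans, Function.comp_apply, hΨι]
    exact Ideal.mem_map_of_mem _ ((Ideal.mem_comap.1 hG))
  -- dimensions
  have hdim𝔭 : ringKrullDim (MvPolynomial (Fin 4) ℂ ⧸ 𝔭₄) = (2 : ℕ) := by
    have h := hmm.2.2.1
    unfold zariskiDim at h
    rw [← h]
    exact (ringKrullDim_eq_of_ringEquiv (Ideal.quotientEquiv 𝔭 𝔭₄ f rfl)).symm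
  have hdimF : ringKrullDim (MvPolynomial (Fin 4) ℂ ⧸ (Ideal.span {F₄} : Ideal (MvPolynomial (Fin 4) ℂ)))
      = ((4 - 1 : ℕ) : WithBot ℕ∞) :=
    Literature.RingTheory.KrullDimension.ringKrullDim_quotient_span_of_prime_mvPolynomial hprimeF₄
  obtain ⟨n𝔮, hn𝔮, -⟩ := Literature.RingTheory.MvPolynomial.exists_nat_ringKrullDim_quotient_eq
    (I := 𝔮₄) h𝔮₄p.ne_top
  have hle1 := Literature.RingTheory.Elimination.ringKrullDim_quotient_add_one_le_of_lt h1 h1ne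
  rw [hdimF, hn𝔮] at hle1
  have hn𝔮2 : n𝔮 + 1 ≤ 3 := by
    have : ((n𝔮 + 1 : ℕ) : WithBot ℕ∞) ≤ ((4 - 1 : ℕ) : WithBot ℕ∞) := by push_cast; exact hle1
    exact_mod_cast this
  have heq : 𝔮₄ = 𝔭₄ := by
    by_contra hne
    have hle2 := Literature.RingTheory.Elimination.ringKrullDim_quotient_add_one_le_of_lt h2 hne
    rw [hdim𝔭, hn𝔮] at hle2
    have h3 : 2 + 1 ≤ n𝔮 := by
      have : ((2 + 1 : ℕ) : WithBot ℕ∞) ≤ (n𝔮 : WithBot ℕ∞) := by push_cast; exact hle2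
      exact_mod_cast this
    omega
  -- conclusion: `W` is invariant under `y₀ ↦ t`
  intro w hwW t
  have hWcl : W = MvPolynomial.zeroLocus ℂ 𝔭 := eq_zeroLocus_vanishingIdeal_of_isZariskiClosed hmm.1.1
  rw [hWcl, MvPolynomial.mem_zeroLocus_iff]
  intro G hG
  -- `G = ι Gy` with all coefficients of `Gy` in `𝔭'`
  have hG₄ : f G ∈ 𝔮₄ := by rw [heq]; exact Ideal.mem_map_of_mem _ hG
  obtain ⟨Gy, hGy𝔮, hGyG⟩ := (Ideal.mem_map_of_equiv Θ (I := 𝔮₀) (f G)).1 hG₄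
  have hGy : ι Gy = G := by
    have h := hGyG
    rw [hΘ, RingEquiv.coe_trans, Function.comp_apply, hΨι] at h
    exact f.injective h
  have hcoef : ∀ m, Gy.coeff m ∈ 𝔭' := (Ideal.mem_map_C_iff.1 hGy𝔮)
  rw [MvPolynomial.aeval_eq_eval, ← hGy, hev]
  simp only [Function.update_self,
    Function.update_of_ne (show (Sum.inl 0 : Fin 2 ⊕ Fin 2) ≠ Sum.inr 0 by decide),
    Function.update_of_ne (show (Sum.inl 1 : Fin 2 ⊕ Fin 2) ≠ Sum.inr 0 by decide),
    Function.update_of_ne (show (Sum.inr 1 : Fin 2 ⊕ Fin 2) ≠ Sum.inr 0 by decide)]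
  rw [eval_map_eq_rowSum Gy _ le_rfl]
  refine Finset.sum_eq_zero fun m _ => ?_
  rw [(hmem' _).1 (hcoef m) w hwW, zero_mul]

/-- **THE COMPLETE VERDICT OVER CURVES OVER `ℚ̄` WITH A HORIZONTAL ASYMPTOTE.**  `F ∈ ℚ̄[x₀][x₁]`
irreducible of `x₁`-degree `≥ 2` with a root of its top row, whose transpose `Ft` is irreducible
with algebraic coefficients: EVERY surface of Mantova–Masser's case with base curve `{F = 0}` has
Zariski-dense exponential points. [cite: MantovaMasser2023, §1 Further remarks, p. 5 (the
question, open in general)] (new) -/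
theorem unprojectedDense_of_mmCase_topRowRoot_algebraic (hFirr : Irreducible F) (hn : 2 ≤ F.natDegree)
    (N : ℕ) (hN : ∀ j, (F.coeff j).natDegree ≤ N) (T : ℂ[X])
    (hT : ∀ j, T.coeff j = (F.coeff j).coeff N) (hT0 : T ≠ 0) {θ : ℂ} (hTθ : T.IsRoot θ)
    (Ft : ℂ[X][X]) (hFt : ∀ x y : ℂ, (Ft.map (Polynomial.evalRingHom x)).eval y =
      (F.map (Polynomial.evalRingHom y)).eval x)
    (hFtirr : Irreducible Ft) (halgt : ∀ i j, IsAlgebraic ℚ ((Ft.coeff j).coeff i))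
    (F₃ : MvPolynomial (Fin 3) ℂ)
    (hF₃ : ∀ v : Fin 3 → ℂ, MvPolynomial.eval v F₃ = (F.map (Polynomial.evalRingHom (v 0))).eval (v 1))
    {W : Set (Fin 2 ⊕ Fin 2 → ℂ)} (hmm : MMCaseDimPiOneFree W)
    (hbase : MvPolynomial.zeroLocus ℂ (MvPolynomial.vanishingIdeal ℂ (projAdd '' (W ∩ torusLocus ℂ 2))) =
      {x : Fin 2 → ℂ | (F.map (Polynomial.evalRingHom (x 0))).eval (x 1) = 0}) :
    UnprojectedDense W := by
  classical
  by_cases hfree : ∀ H : MvPolynomial (Fin 3) ℂ,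
      (∀ w ∈ W, MvPolynomial.eval ![w (Sum.inl 0), w (Sum.inl 1), w (Sum.inr 1)] H = 0) → F₃ ∣ H
  · exact unprojectedDense_of_mmCase_topRowRoot F hFirr hn N hN T hT hT0 hTθ F₃ hF₃ hmm hbase hfree
  · push Not at hfree
    obtain ⟨H, hHW, hH⟩ := hfree
    exact unprojectedDense_of_mmCase_cylinder₀ F Ft hFt hFtirr halgt hmm hbase
      (cylinder₀_of_relation F hFirr F₃ hF₃ hmm hbase H hH hHW)

/-- **Every surface of Mantova–Masser's case over the conic `x₁² + x₀x₁ + x₀ = 0` is dense.**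
(Transpose `x₀² + x₀x₁ + x₁`, irreducible of `x₁`-degree `1` and not a line; top row `x₁ + 1`.)
[cite: MantovaMasser2023, §1 Further remarks, p. 5 (the question, open in general)] (new) -/
theorem unprojectedDense_of_mmCase_conicE_all {W : Set (Fin 2 ⊕ Fin 2 → ℂ)}
    (hmm : MMCaseDimPiOneFree W)
    (hbase : MvPolynomial.zeroLocus ℂ (MvPolynomial.vanishingIdeal ℂ (projAdd '' (W ∩ torusLocus ℂ 2))) =
      {x : Fin 2 → ℂ | x 1 ^ 2 + x 0 * x 1 + x 0 = 0}) :
    UnprojectedDense W := by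
  classical
  -- the transpose `Ft = (x₀ + 1)·x₁ + x₀²` as a polynomial in `x₁` over `ℂ[x₀]`
  set Ft : ℂ[X][X] := Polynomial.C (X + 1 : ℂ[X]) * X + Polynomial.C (X ^ 2 : ℂ[X]) with hFt
  have hFtev : ∀ x y : ℂ, (Ft.map (Polynomial.evalRingHom x)).eval y = (x + 1) * y + x ^ 2 := by
    intro x y; simp [hFt]
  have hswap : ∀ x y : ℂ, (Ft.map (Polynomial.evalRingHom x)).eval y =
      ((X ^ 2 + Polynomial.C (X : ℂ[X]) * X + Polynomial.C (X : ℂ[X]) : ℂ[X][X]).map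
        (Polynomial.evalRingHom y)).eval x := by
    intro x y; rw [hFtev, conicE_eval]; ring
  -- `Ft` is irreducible: degree one in `x₁` with coprime coefficients
  have hc0 : Ft.coeff 0 = X ^ 2 := by
    rw [hFt, Polynomial.coeff_add, Polynomial.coeff_C_mul, Polynomial.coeff_X_zero, mul_zero, zero_add,
      Polynomial.coeff_C_zero]
  have hc1 : Ft.coeff 1 = X + 1 := by
    rw [hFt, Polynomial.coeff_add, Polynomial.coeff_C_mul, Polynomial.coeff_X_one, mul_one,
      Polynomial.coeff_C, if_neg one_ne_zero, add_zero]
  have hcj : ∀ j, 2 ≤ j → Ft.coeff j = 0 := by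
    intro j hj
    rw [hFt, Polynomial.coeff_add, Polynomial.coeff_C_mul, Polynomial.coeff_X, Polynomial.coeff_C,
      if_neg (by omega), if_neg (by omega), mul_zero, add_zero]
  have hFtdeg : Ft.degree = 1 := by
    rw [hFt]; compute_degree!; exact Polynomial.X_add_C_ne_zero 1
  have hFtirr : Irreducible Ft := by
    refine Polynomial.irreducible_of_degree_eq_one_of_isRelPrime_coeff hFtdeg ?_
    rw [hc0, hc1]
    exact (show IsCoprime (X ^ 2 : ℂ[X]) (X + 1) from ⟨1, 1 - X, by ring⟩).isRelPrime
  have halgt : ∀ i j, IsAlgebraic ℚ ((Ft.coeff j).coeff i) := by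
    intro i j
    have h01 : (Ft.coeff j).coeff i = 0 ∨ (Ft.coeff j).coeff i = 1 := by
      rcases j with _ | _ | j
      · rw [hc0, Polynomial.coeff_X_pow]; split_ifs <;> simp
      · rw [hc1, Polynomial.coeff_add, Polynomial.coeff_X, Polynomial.coeff_one]
        rcases i with _ | _ | i <;> simp
      · rw [hcj (j + 2) (by omega), Polynomial.coeff_zero]; simp
    rcases h01 with h | h
    · rw [h]; exact isAlgebraic_zero
    · rw [h]; exact isAlgebraic_one
  have hF₃ev : ∀ v : Fin 3 → ℂ, MvPolynomial.eval v (MvPolynomial.X 1 ^ 2 +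
      MvPolynomial.X 0 * MvPolynomial.X 1 + MvPolynomial.X 0 : MvPolynomial (Fin 3) ℂ) =
      ((X ^ 2 + Polynomial.C (X : ℂ[X]) * X + Polynomial.C (X : ℂ[X]) : ℂ[X][X]).map
        (Polynomial.evalRingHom (v 0))).eval (v 1) := by
    intro v; rw [conicE_eval]; simp
  refine unprojectedDense_of_mmCase_topRowRoot_algebraic _ conicE_irreducible
    (by rw [conicE_natDegree]) 1 (fun j => ?_) (X + 1) (fun j => ?_) (Polynomial.X_add_C_ne_zero 1)
    (θ := -1) (by simp) Ft hswap hFtirr halgt _ hF₃ev hmm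
    (by rw [hbase]; ext x; simp only [Set.mem_setOf_eq, conicE_eval])
  · rw [conicE_coeff]; split_ifs <;> simp
  · rw [conicE_coeff, Polynomial.coeff_add, Polynomial.coeff_X, Polynomial.coeff_one]
    rcases j with _ | _ | _ | j <;> simp [Polynomial.coeff_one]

end CylinderCriterion

end Summit.Schanuel.Schanuel.Theorems
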